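import Mathlib.GroupTheory.Index
import Literature.AnabelianGeometry.SemiGraphs.TemperedQuasiGeometricCompatible
import Literature.AnabelianGeometry.SemiGraphs.TemperedReconstructionReductionsProofs
import Literature.AnabelianGeometry.SemiGraphs.TemperedReconstructionVertexMapProofs
import Literature.AnabelianGeometry.SemiGraphs.TemperedVerticialDistinctSameVertex
import HarnessLib

/-!
# Definition 3.8, compatible reading: INJECTIVE quasi-geometric homomorphisms are compatibly
# quasi-geometric (proof-only)

Mochizuki, *Semi-graphs of anabelioids*, Publ. RIMS **42** (2006), §3, Def. 3.8 / Cor. 3.9 p. 42,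
Thm. 3.7 (ii), (iv) pp. 40–41 [cite: MochizukiSemiAnbd2006, Def 3.8 p.42].  Toward the (a)-direction
of Cor. 3.9 over the compatible reading (`IsCompatiblyQuasiGeometric`, ruling χ2 on finding
t2g2-F1): if `φ : π₁^temp(G) → Π` is quasi-geometric in the literal sense and INJECTIVE (the case of
finite étale coverings and of embeddings), then it is compatibly quasi-geometric
(`isCompatiblyQuasiGeometric_of_injective`): were two distinct maximal compact
`K₁ ≠ H₁` (verticial, Thm. 3.7 (iv)) carried into ONE maximal compact `Q`, their images would be open
in `Q`, so `φ(H₁)` would have finite index over `φ(K₁) ∩ φ(H₁) = φ(K₁ ∩ H₁)`; but `K₁ ∩ H₁` has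
infinite index in `K₁` (Thm. 3.7 (ii), `verticialDistinct_holds`), and injectivity transports indices.
Hence a homomorphism induced by a locally open morphism is compatibly quasi-geometric as soon as it
is injective (`isCompatiblyQuasiGeometric_of_compat_of_injective`, with R0
`InducedIsQuasiGeometric_of`).  The non-injective case needs the coherence of the chart pull-back
(as for R1) and is not treated.  Nothing here takes a side on [IUTchIII] Cor. 3.12.
-/

open Topology

namespace Literature.AnabelianGeometry.SemiGraphs

namespace ProfiniteSemiGraph

universe u

variable {𝒢 ℋ : ProfiniteSemiGraph.{u}}

/-- Conjugating a subgroup by one of its own elements does nothing. [folklore] -/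
private theorem map_conj_eq_self_of_mem {Γ : Type u} [Group Γ] {K : Subgroup Γ} {g : Γ} (hg : g ∈ K) :
    K.map (MulAut.conj g).toMonoidHom = K := by
  ext x
  rw [Subgroup.mem_map_equiv, MulAut.conj_symm_apply]
  constructor
  · intro h
    have := K.mul_mem (K.mul_mem hg h) (K.inv_mem hg)
    simpa [mul_assoc] using this
  · intro h
    exact K.mul_mem (K.mul_mem (K.inv_mem hg) h) hg

/-- Two distinct verticial subgroups meet with infinite index (Thm. 3.7 (ii), both clauses, PROVED in
the tree as `verticialDistinct_holds`; at one vertex the two are conjugate by a non-member, by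
commensurable terminality). [cite: MochizukiSemiAnbd2006, Thm 3.7(ii) p.40] -/
theorem relIndex_eq_zero_of_verticial_ne (h𝒢 : 𝒢.Thm37Hypotheses) (c : TemperedPiChart 𝒢)
    {v₁ v₂ : 𝒢.graph.Vertex} {K₁ H₁ : Subgroup c.G} (hK₁ : K₁ ∈ verticialSubgroups c v₁)
    (hH₁ : H₁ ∈ verticialSubgroups c v₂) (hne : K₁ ≠ H₁) : H₁.relIndex K₁ = 0 := by
  by_cases hv : v₁ = v₂
  · subst hv
    obtain ⟨g, rfl⟩ := exists_conj_of_mem_verticialSubgroups c hK₁ hH₁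
    have hg : g ∉ K₁ := fun hg => hne (map_conj_eq_self_of_mem hg).symm
    have h0 := (verticialDistinct_holds 𝒢 h𝒢 c).2 v₁ K₁ hK₁ 1 g (by simpa using hg)
    rwa [map_one, show K₁.map (1 : MulAut c.G).toMonoidHom = K₁ from by ext x; simp] at h0
  · exact (verticialDistinct_holds 𝒢 h𝒢 c).1 v₁ v₂ K₁ H₁ hK₁ hH₁ hv

/-- **Injective quasi-geometric homomorphisms are compatibly quasi-geometric** (Def. 3.8, compatible
reading; the source a semi-graph of anabelioids under the hypotheses of Thm. 3.7, with Thm. 3.7 (iv)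
as a binder). [cite: MochizukiSemiAnbd2006, Def 3.8 p.42] -/
theorem isCompatiblyQuasiGeometric_of_injective
    (h37iv : MaximalCompactIffVerticial.{u}) (h𝒢 : 𝒢.Thm37Hypotheses) (c𝒢 : TemperedPiChart 𝒢)
    {Γ : Type u} [Group Γ] [TopologicalSpace Γ] [IsTopologicalGroup Γ] {φ : c𝒢.G →ₜ* Γ}
    (hq : IsQuasiGeometric φ) (hinj : Function.Injective φ) : IsCompatiblyQuasiGeometric φ := by
  refine ⟨hq, fun K₁ H₁ hK₁ hH₁ hne hnt => ?_⟩
  obtain ⟨hmax, -⟩ := h37iv 𝒢 h𝒢 c𝒢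
  obtain ⟨v₁, hK₁v⟩ := (hmax K₁).mp hK₁
  obtain ⟨v₂, hH₁v⟩ := (hmax H₁).mp hH₁
  obtain ⟨K₂, hK₂, hmK⟩ := hq.maximal K₁ hK₁
  obtain ⟨H₂, hH₂, hmH⟩ := hq.maximal H₁ hH₁
  by_cases h : K₂ = H₂
  · exfalso
    subst h
    -- source: infinite index; injectivity transports it
    have h1 : (H₁.map φ.toMonoidHom).relIndex (K₁.map φ.toMonoidHom) = 0 := by
      rw [Subgroup.relIndex_map_map_of_injective _ _ hinj]
      exact relIndex_eq_zero_of_verticial_ne h𝒢 c𝒢 hK₁v hH₁v hne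
    -- target: `φ(H₁)` has finite index in `K₂ ⊇ φ(K₁)`
    have h2 : (H₁.map φ.toMonoidHom).relIndex K₂ ≠ 0 :=
      relIndex_ne_zero_of_mapsOnto φ.toMonoidHom hK₂.1 hmH
    exact h2 (Subgroup.relIndex_eq_zero_of_le_right hmK.1 h1)
  · exact ⟨K₂, H₂, hK₂, hH₂, h, hmK.1, hmH.1⟩

/-- **An INJECTIVE homomorphism compatible with a locally open morphism is compatibly
quasi-geometric** (Cor. 3.9 (a) over the compatible reading, injective case): R0
`InducedIsQuasiGeometric_of` gives the literal Def. 3.8, injectivity the compatibility.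
[cite: MochizukiSemiAnbd2006, Cor 3.9 p.42] -/
theorem isCompatiblyQuasiGeometric_of_compat_of_injective (h37i : VerticialInjective.{u})
    (h37iv : MaximalCompactIffVerticial.{u}) (h𝒢 : Cor39Hypotheses 𝒢) (hℋ : Cor39Hypotheses ℋ)
    (c𝒢 : TemperedPiChart 𝒢) (cℋ : TemperedPiChart ℋ) (F : Hom 𝒢 ℋ) (φ : c𝒢.G →ₜ* cℋ.G)
    (hF : F.IsLocallyOpen) (hV : F.CompatV c𝒢 cℋ φ) (hE : F.CompatE c𝒢 cℋ φ)
    (hinj : Function.Injective φ) : IsCompatiblyQuasiGeometric φ :=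
  isCompatiblyQuasiGeometric_of_injective h37iv h𝒢.thm37Hypotheses c𝒢
    (InducedIsQuasiGeometric_of h37i h37iv 𝒢 ℋ h𝒢 hℋ c𝒢 cℋ F φ hF hV hE) hinj

end ProfiniteSemiGraph

end Literature.AnabelianGeometry.SemiGraphs
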